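import Mathlib.Analysis.Complex.Basic
import Literature.Computability.AlgebraicComplexity.StandardFamilies

/-!
# Route LiftNullstellensatz — `LiftWidthPerFour` (stmt-ValiantsHypothesis-5922): CASE A reduces to rows `0, 3`

The registered stub `stub_caseA` of the line `Cruxes/LiftWidthPerFour/Lines/outer_layers.lean`
quantifies over all pairs of distinct rows `i₀ ≠ i₁` of the `4 × 4` variable matrix.  The
generic permanent is invariant under permutations of the rows (`rename_prodMap_rows_perPoly`),
and a row permutation `σ` with `σ 0 = i₀`, `σ 3 = i₁` transports the row ideals
`(X_{i₀ ·}, ℓ)`, `(X_{i₁ ·}, ℓ')` to `(X_{0 ·}, σ⁻¹ℓ)`, `(X_{3 ·}, σ⁻¹ℓ')` and preserves homogeneity,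
so CASE A for the fixed rows `(0, 3)` implies CASE A for every pair of distinct rows
(`caseA_of_caseA_rows_zero_three`).  Pure bookkeeping for the provers of `stub_caseA`
(rung 1: val-width-5922-p2; general: open).  No new definitions.  VP ≠ VNP is not moved.
-/

namespace Summit.ValiantsHypothesis.LiftNullstellensatz

open MvPolynomial Literature.Computability.AlgebraicComplexity

/-- The generic permanent is invariant under a permutation of the ROWS of the variable matrix:
renaming `X (i, j) ↦ X (σ i, j)` fixes `perPoly`. [folklore] -/
theorem rename_prodMap_rows_perPoly {n : Type*} [Fintype n] [DecidableEq n] (R : Type*)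
    [CommRing R] (σ : Equiv.Perm n) :
    rename (Prod.map σ id) (perPoly n R) = perPoly n R := by
  have h : rename (Prod.map (σ : n → n) id) (perPoly n R) =
      ((Matrix.mvPolynomialX n n R).submatrix σ id).permanent := by
    simp [perPoly, Matrix.permanent, map_sum, map_prod, Matrix.mvPolynomialX, rename_X]
  rw [h, Matrix.permanent_permute_cols]
  rfl

/-- A permutation of `Fin 4` sending `0 ↦ i₀` and `3 ↦ i₁` for distinct `i₀ ≠ i₁`. [folklore] -/
theorem exists_perm_zero_three (i₀ i₁ : Fin 4) (h : i₀ ≠ i₁) :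
    ∃ σ : Equiv.Perm (Fin 4), σ 0 = i₀ ∧ σ 3 = i₁ := by
  classical
  let σ₁ : Equiv.Perm (Fin 4) := Equiv.swap 0 i₀
  let j : Fin 4 := σ₁.symm i₁
  have hj0 : j ≠ 0 := by
    intro hj
    have : σ₁ j = i₁ := by simp [j]
    rw [hj] at this
    simp [σ₁, Equiv.swap_apply_left] at this
    exact h this
  refine ⟨(Equiv.swap (3 : Fin 4) j).trans σ₁, ?_, ?_⟩
  · have h30 : (3 : Fin 4) ≠ 0 := by decide
    rw [Equiv.trans_apply, Equiv.swap_apply_of_ne_of_ne h30.symm hj0.symm]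
    simp [σ₁, Equiv.swap_apply_left]
  · rw [Equiv.trans_apply, Equiv.swap_apply_left]
    simp [j]

/-- Transport of a row ideal `(X_{i ·}, ℓ)` under the row renaming `X (i, j) ↦ X (τ i, j)`:
its image lies in `(X_{τ i ·}, rename ℓ)`. [folklore] -/
theorem map_rename_rows_rowIdeal_le (τ : Equiv.Perm (Fin 4)) (i : Fin 4)
    (m : MvPolynomial (Fin 4 × Fin 4) ℂ) :
    Ideal.map (rename (Prod.map τ id) :
        MvPolynomial (Fin 4 × Fin 4) ℂ →ₐ[ℂ] MvPolynomial (Fin 4 × Fin 4) ℂ)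
        (Ideal.span (insert m (Set.range fun j : Fin 4 =>
          (X (i, j) : MvPolynomial (Fin 4 × Fin 4) ℂ)))) ≤
      Ideal.span (insert (rename (Prod.map τ id) m) (Set.range fun j : Fin 4 =>
        (X (τ i, j) : MvPolynomial (Fin 4 × Fin 4) ℂ))) := by
  rw [Ideal.map_span, Ideal.span_le]
  rintro _ ⟨f, hf, rfl⟩
  rcases hf with rfl | ⟨j, rfl⟩
  · exact Ideal.subset_span (Set.mem_insert _ _)
  · refine Ideal.subset_span (Set.mem_insert_of_mem _ ⟨j, ?_⟩)
    simp [rename_X]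

/-- **CASE A reduces to the rows `(0, 3)`.**  If `per_4` is not a sum of `b ≤ 5` products of
quadrics `v_s ∈ (X_{0 ·}, ℓ)`, `v'_s ∈ (X_{3 ·}, ℓ')` for any linear `ℓ, ℓ'`, then the same holds
for every pair of distinct rows `i₀ ≠ i₁` — the shape of the registered stub `stub_caseA`.
[folklore] -/
theorem caseA_of_caseA_rows_zero_three
    (h03 : ∀ b : ℕ, b ≤ 5 →
      ∀ ℓ ℓ' : MvPolynomial (Fin 4 × Fin 4) ℂ, ℓ.IsHomogeneous 1 → ℓ'.IsHomogeneous 1 →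
      ∀ v v' : Fin b → MvPolynomial (Fin 4 × Fin 4) ℂ,
        (∀ s, v s ∈ Ideal.span (insert ℓ (Set.range fun j : Fin 4 =>
          (X ((0 : Fin 4), j) : MvPolynomial (Fin 4 × Fin 4) ℂ)))) →
        (∀ s, (v s).IsHomogeneous 2) →
        (∀ s, v' s ∈ Ideal.span (insert ℓ' (Set.range fun j : Fin 4 =>
          (X ((3 : Fin 4), j) : MvPolynomial (Fin 4 × Fin 4) ℂ)))) →
        (∀ s, (v' s).IsHomogeneous 2) →
        perPoly (Fin 4) ℂ ≠ ∑ s, v s * v' s) :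
    ∀ b : ℕ, b ≤ 5 → ∀ i₀ i₁ : Fin 4, i₀ ≠ i₁ →
      ∀ ℓ ℓ' : MvPolynomial (Fin 4 × Fin 4) ℂ, ℓ.IsHomogeneous 1 → ℓ'.IsHomogeneous 1 →
      ∀ v v' : Fin b → MvPolynomial (Fin 4 × Fin 4) ℂ,
        (∀ s, v s ∈ Ideal.span (insert ℓ (Set.range fun j : Fin 4 =>
          (X (i₀, j) : MvPolynomial (Fin 4 × Fin 4) ℂ)))) →
        (∀ s, (v s).IsHomogeneous 2) →
        (∀ s, v' s ∈ Ideal.span (insert ℓ' (Set.range fun j : Fin 4 =>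
          (X (i₁, j) : MvPolynomial (Fin 4 × Fin 4) ℂ)))) →
        (∀ s, (v' s).IsHomogeneous 2) →
        perPoly (Fin 4) ℂ ≠ ∑ s, v s * v' s := by
  intro b hb i₀ i₁ hne ℓ ℓ' hℓ hℓ' v v' hv hv2 hv' hv'2 hper
  obtain ⟨σ, h0, h3⟩ := exists_perm_zero_three i₀ i₁ hne
  -- rename along the inverse row permutation: row i₀ ↦ row 0, row i₁ ↦ row 3
  let τ : MvPolynomial (Fin 4 × Fin 4) ℂ →ₐ[ℂ] MvPolynomial (Fin 4 × Fin 4) ℂ :=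
    rename (Prod.map σ.symm id)
  have hτper : τ (perPoly (Fin 4) ℂ) = perPoly (Fin 4) ℂ := rename_prodMap_rows_perPoly ℂ σ.symm
  have hi₀ : σ.symm i₀ = 0 := by rw [← h0, Equiv.symm_apply_apply]
  have hi₁ : σ.symm i₁ = 3 := by rw [← h3, Equiv.symm_apply_apply]
  have hper' : perPoly (Fin 4) ℂ = ∑ s, τ (v s) * τ (v' s) := by
    calc perPoly (Fin 4) ℂ = τ (perPoly (Fin 4) ℂ) := hτper.symm
      _ = τ (∑ s, v s * v' s) := by rw [← hper]
      _ = ∑ s, τ (v s) * τ (v' s) := by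
        rw [map_sum]
        exact Finset.sum_congr rfl fun s _ => map_mul τ _ _
  refine h03 b hb (τ ℓ) (τ ℓ') hℓ.rename_isHomogeneous hℓ'.rename_isHomogeneous
    (fun s => τ (v s)) (fun s => τ (v' s)) ?_ (fun s => (hv2 s).rename_isHomogeneous) ?_
    (fun s => (hv'2 s).rename_isHomogeneous) hper'
  · intro s
    have := map_rename_rows_rowIdeal_le σ.symm i₀ ℓ (Ideal.mem_map_of_mem _ (hv s))
    rwa [hi₀] at this
  · intro s
    have := map_rename_rows_rowIdeal_le σ.symm i₁ ℓ' (Ideal.mem_map_of_mem _ (hv' s))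
    rwa [hi₁] at this

end Summit.ValiantsHypothesis.LiftNullstellensatz
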